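import Literature.NumberTheory.LFunctions.Zhang2022.Section8ChangeOfVariables
import Literature.NumberTheory.LFunctions.Zhang2022.Section18Certificate

/-!
# Zhang (2022) §9: the same two changes of variables for `Ξ₁₂`, and the prefactor of (9.5)–(9.6), kernel-checked

Trunk T-ANT (NumberTheory/LFunctions). Companion of `Section8ChangeOfVariables.lean` (§8) and of
`Section18Defs.lean` / `Section18Certificate.lean` (which transcribe and certify §9's `b₃₃, b₄₄, b₃₄,
b₄₃`, `𝔠₂`, (9.8) in BOTH readings of the prefactor of (9.5)–(9.6): `b34/b43/frakc2` as printed,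
`((0.504)(0.498)π)⁻¹`, and `b34c/b43c/frakc2c` with `((0.5)(0.498)π)⁻¹`). Source: Y. Zhang,
*Discrete mean estimates and the Landau–Siegel zero*, arXiv:2211.02515v1 (2022)
[Zhang2022LandauSiegel], §9, p. 19 of the source — **an unrefereed manuscript, a claimed result
under adjudication; this file reproduces an elementary-calculus passage of its §9 and asserts nothing
about its Theorems 1–2.**

§9 evaluates `Ξ₁₂ = 2Re Θ₁(a₁₂, a₂₂) + o(𝔓)` (9.1) with `a₁₂ = χ(ῑ₃ϰ₃ + ῑ₄ϰ₂)` (9.2), `ϰ₃` living on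
`n < P₃ = P^{0.498}`, `ϰ₂` on `n < P₂ = P^{0.5}T^{-10}` ((2.21), (8.6)). "By Lemma 8.2 and 8.4 … in a
way similar to the proof of (8.12)" the text displays [p. 19, lines 30–36 of the held text]
`S_j(a₁₂,a₂₂) = 𝔞∫₁^{P₃}(ῑ₃𝔣_{j6}(P₃/x)/log P₃ + ῑ₄𝔣_{j7}(P₂/x)/log P₂)(ι₃𝔤_{j6}(P₃/x)/log P₃ + ι₄𝔤_{j7}(P₂/x)/log P₂)dx/x
  + |ι₄|²𝔞(log P₂)⁻² ∫_{P₃}^{P₂} 𝔣_{j7}(P₂/x)𝔤_{j7}(P₂/x)dx/x + o(α)`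
(a stray `Σ_{r<D}` printed in front of the first integral is not reproduced), then "by the change of
variables `x → P₂/x` or `x → P₃/x`" its four-term form (`P₂/P₃ = P^{0.002}T^{-10}`), then "by
substituting `x = Pᶻ`"
`(2α)⁻¹S₁ + 2α⁻¹S₂ + (3/2)α⁻¹S₃ = 𝔞(|ι₃|²b₃₃ + ι₃ῑ₄b₃₄ + ι₄ῑ₃b₄₃ + |ι₄|²b₄₄) + o(1)`
with (9.3)–(9.6), and `𝔠₂ = |ι₃|²c₃₃ + ι₃ῑ₄c₃₄ + ι₄ῑ₃c₄₃ + |ι₄|²c₄₄` (display after (9.7)).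

This is EXACTLY the §8 computation with the roles (long scale, short scale) = (`P₁`, `P₂`) replaced by
(`P₂`, `P₃`), the profile indices `6 ↔ 7` exchanged accordingly, and general coefficients on both
factors. This file therefore (i) generalises `S811`/`S812` to arbitrary coefficients
`(u_L, u_S; v_L, v_S)` on the (long, short) profiles of the `m`- and `n`-factor — `S811g`, `S812g`, with
`S811 = S811g 1 ι₂ 1 ῑ₂` (`S811_eq_S811g`) — and proves `S811g = S812g` and its `z`-form for ANY
continuous profiles and ANY exponents `θ_L, θ_S`; (ii) specialises to §9: coefficients
`(ῑ₄, ῑ₃; ι₄, ι₃)`, long profile `𝔣_{j7}, 𝔤_{j7}` at `θ_L = 0.5`, short profile `𝔣_{j6}, 𝔤_{j6}` at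
`θ_S = 0.498`, shifts at main values, `α log P = π`.

RESULT (`weighted_sum_S911_main`): the weighted sum of the §9 display equals
`|ι₃|²b₃₃ + ι₃ῑ₄·b34c + ι₄ῑ₃·b43c + |ι₄|²b₄₄` — i.e. (9.3), (9.4) as printed and (9.5), (9.6) WITH THE
PREFACTOR `((0.5)(0.498)π)⁻¹` (from `(log P₂)(log P₃) = (0.5)(0.498)(log P)²` and `α log P = π`; the
`Section18Defs.b34c/b43c` reading), NOT the printed `((0.504)(0.498)π)⁻¹` (`b34c = 1.008·b34`,
`prefactor_95_96`; `0.504` is the exponent of `P₁`, which does not occur in §9). Consequently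
(`weighted_sum_S911_add_conj`) `W + W̄ = frakc2c` (`= 6.98709…`, `Section18Certificate.frakc2c_re_bounds`),
the printed (9.8) `𝔠₂ < 6.9955` HOLDS for it (`ineq98c`), and `W + W̄ ≠ frakc2` (the printed-prefactor
value `6.99491…`). This settles, inside the kernel and from the manuscript's own display, the reading
adopted on numerical grounds by the repair cell (the printed `c₃₄ = −0.4526 + 0.19474i` is the
`0.5`-reading's `c34c ∈ (−0.452605, −0.452604) + i(0.194741, 0.194742)`, not the printed-prefactor
`c34 = −0.44901… + 0.19319…i`): the `0.504` in (9.5)–(9.6) is a misprint without consequence.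

Idealisations — the manuscript's own `o(·)` steps only, as in `Section8ChangeOfVariables`: (M1) shifts at
their main values; (M2) `P₂ = P^{θ_L}` with `θ_L` at its main value `0.5` (true value
`0.5 − 10ℒ^{-7.9}`) only in the final identification — `S811g_eq_S812g`, `S812g_eq_zform` hold for every
`θ_L, θ_S`; (M3) `𝔞`, `o(α)` omitted. NOT here: everything analytic (Prop 7.1, Lemmas 8.1–8.4 with
their error terms, `λ₀ⱼ`, the partial summation producing the display).
-/

noncomputable section

open Complex Real Set MeasureTheory ComplexConjugate

namespace Literature.NumberTheory.LFunctions.Zhang2022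

/-! ### The two-scale bilinear functional with general coefficients -/

/-- The (8.11)-shaped two-scale functional with general coefficients: scales `Q_L = P^{θ_L}` (long) and
`Q_S = P^{θ_S}` (short), `m`-factor `u_L F_L(Q_L/x)/log Q_L + u_S F_S(Q_S/x)/log Q_S`, `n`-factor
`v_L G_L(Q_L/x)/log Q_L + v_S G_S(Q_S/x)/log Q_S`:
`∫₁^{Q_S} (m-factor)(n-factor) dx/x + u_L v_L (log Q_L)⁻² ∫_{Q_S}^{Q_L} F_L(Q_L/x)G_L(Q_L/x) dx/x`.
§8 (8.11): `(u_L,u_S;v_L,v_S) = (1, ι₂; 1, ῑ₂)`, `(F_L,F_S) = (𝔣_{j6},𝔣_{j7})`, `(θ_L,θ_S) = (0.504, 0.5)`;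
§9 (display p. 19): `(ῑ₄, ῑ₃; ι₄, ι₃)`, `(𝔣_{j7}, 𝔣_{j6})`, `(0.5, 0.498)`.
[cite: Zhang2022LandauSiegel, (8.11), §9] -/
def S811g (uL uS vL vS : ℂ) (Fl Fs Gl Gs : ℝ → ℂ) (Λ θL θS : ℝ) : ℂ :=
  (∫ x in (1:ℝ)..Ppow Λ θS,
      (uL * Fl (Ppow Λ θL / x) / Real.log (Ppow Λ θL) + uS * Fs (Ppow Λ θS / x) / Real.log (Ppow Λ θS))
        * (vL * Gl (Ppow Λ θL / x) / Real.log (Ppow Λ θL)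
            + vS * Gs (Ppow Λ θS / x) / Real.log (Ppow Λ θS)) / x)
    + uL * vL / (Real.log (Ppow Λ θL) : ℂ) ^ 2
        * ∫ x in Ppow Λ θS..Ppow Λ θL, Fl (Ppow Λ θL / x) * Gl (Ppow Λ θL / x) / x

/-- The (8.12)-shaped four-term form with general coefficients:
`u_L v_L(log Q_L)⁻²∫₁^{Q_L}F_L G_L dx/x + u_S v_S(log Q_S)⁻²∫₁^{Q_S}F_S G_S dx/x
 + u_S v_L(log Q_L log Q_S)⁻¹∫₁^{Q_S}F_S(x)G_L((Q_L/Q_S)x)dx/x + u_L v_S(log Q_L log Q_S)⁻¹∫₁^{Q_S}F_L((Q_L/Q_S)x)G_S(x)dx/x`.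
[cite: Zhang2022LandauSiegel, (8.12), §9] -/
def S812g (uL uS vL vS : ℂ) (Fl Fs Gl Gs : ℝ → ℂ) (Λ θL θS : ℝ) : ℂ :=
  uL * vL / (Real.log (Ppow Λ θL) : ℂ) ^ 2 * (∫ x in (1:ℝ)..Ppow Λ θL, Fl x * Gl x / x)
    + uS * vS / (Real.log (Ppow Λ θS) : ℂ) ^ 2 * (∫ x in (1:ℝ)..Ppow Λ θS, Fs x * Gs x / x)
    + uS * vL / (Real.log (Ppow Λ θL) * Real.log (Ppow Λ θS) : ℂ)
        * (∫ x in (1:ℝ)..Ppow Λ θS, Fs x * Gl (Ppow Λ θL / Ppow Λ θS * x) / x)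
    + uL * vS / (Real.log (Ppow Λ θL) * Real.log (Ppow Λ θS) : ℂ)
        * (∫ x in (1:ℝ)..Ppow Λ θS, Fl (Ppow Λ θL / Ppow Λ θS * x) * Gs x / x)

/-- `Section8ChangeOfVariables.S811` is the case `(1, ι₂; 1, ῑ₂)` of `S811g`. [folklore] -/
theorem S811_eq_S811g (F6 F7 G6 G7 : ℝ → ℂ) (Λ θ₁ θ₂ : ℝ) :
    S811 F6 F7 G6 G7 Λ θ₁ θ₂ = S811g 1 iota2 1 (conj iota2) F6 F7 G6 G7 Λ θ₁ θ₂ := by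
  unfold S811 S811g
  simp only [one_mul]

/-- `Section8ChangeOfVariables.S812` is the case `(1, ι₂; 1, ῑ₂)` of `S812g` (with `ι₂ῑ₂ = |ι₂|²`).
[folklore] -/
theorem S812_eq_S812g (F6 F7 G6 G7 : ℝ → ℂ) (Λ θ₁ θ₂ : ℝ) :
    S812 F6 F7 G6 G7 Λ θ₁ θ₂ = S812g 1 iota2 1 (conj iota2) F6 F7 G6 G7 Λ θ₁ θ₂ := by
  unfold S812 S812g
  rw [Complex.mul_conj]
  simp only [one_mul, mul_one]

/-- **The change of variable `x → Q_L/x` or `x → Q_S/x`, general coefficients**: `S811g = S812g` for any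
profiles continuous on `(0,∞)` and any `Λ, θ_L, θ_S` (same proof as `S811_eq_S812`).
[cite: Zhang2022LandauSiegel, (8.11)–(8.12), §9] -/
theorem S811g_eq_S812g (uL uS vL vS : ℂ) {Fl Fs Gl Gs : ℝ → ℂ} (hFl : ContinuousOn Fl (Ioi 0))
    (hFs : ContinuousOn Fs (Ioi 0)) (hGl : ContinuousOn Gl (Ioi 0)) (hGs : ContinuousOn Gs (Ioi 0))
    (Λ θL θS : ℝ) :
    S811g uL uS vL vS Fl Fs Gl Gs Λ θL θS = S812g uL uS vL vS Fl Fs Gl Gs Λ θL θS := by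
  have hp1 := Ppow_pos Λ θL
  have hp2 := Ppow_pos Λ θS
  have hc : 0 < Ppow Λ θL / Ppow Λ θS := div_pos hp1 hp2
  set p1 := Ppow Λ θL with hp1def
  set p2 := Ppow Λ θS with hp2def
  set L1 : ℂ := (Real.log p1 : ℂ)
  set L2 : ℂ := (Real.log p2 : ℂ)
  set h66 : ℝ → ℂ := fun u => Fl u * Gl u
  set h77 : ℝ → ℂ := fun u => Fs u * Gs u
  set hX : ℝ → ℂ := fun u => Fs u * Gl (p1 / p2 * u)
  set hY : ℝ → ℂ := fun u => Fl (p1 / p2 * u) * Gs u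
  have c66 : ContinuousOn h66 (Ioi 0) := hFl.mul hGl
  have c77 : ContinuousOn h77 (Ioi 0) := hFs.mul hGs
  have cX : ContinuousOn hX (Ioi 0) := hFs.mul (continuousOn_comp_mul hGl hc)
  have cY : ContinuousOn hY (Ioi 0) := (continuousOn_comp_mul hFl hc).mul hGs
  have expand : ∀ x ∈ uIcc (1:ℝ) p2,
      (uL * Fl (p1 / x) / L1 + uS * Fs (p2 / x) / L2)
          * (vL * Gl (p1 / x) / L1 + vS * Gs (p2 / x) / L2) / x
        = uL * vL / L1 ^ 2 * (h66 (p1 / x) / x) + uS * vS / L2 ^ 2 * (h77 (p2 / x) / x)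
          + uS * vL / (L1 * L2) * (hX (p2 / x) / x) + uL * vS / (L1 * L2) * (hY (p2 / x) / x) := by
    intro x hx
    have hx0 : x ≠ 0 := ((lt_min one_pos hp2).trans_le hx.1).ne'
    have e1 : p1 / p2 * (p2 / x) = p1 / x := by field_simp
    simp only [h66, h77, hX, hY, e1]
    ring
  have I66 : IntervalIntegrable (fun x => h66 (p1 / x) / (x:ℂ)) volume 1 p2 :=
    intervalIntegrable_of_continuousOn_Ioi
      (continuousOn_div_ofReal (continuousOn_comp_div c66 hp1)) one_pos hp2
  have I77 : IntervalIntegrable (fun x => h77 (p2 / x) / (x:ℂ)) volume 1 p2 :=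
    intervalIntegrable_of_continuousOn_Ioi
      (continuousOn_div_ofReal (continuousOn_comp_div c77 hp2)) one_pos hp2
  have IX : IntervalIntegrable (fun x => hX (p2 / x) / (x:ℂ)) volume 1 p2 :=
    intervalIntegrable_of_continuousOn_Ioi
      (continuousOn_div_ofReal (continuousOn_comp_div cX hp2)) one_pos hp2
  have IY : IntervalIntegrable (fun x => hY (p2 / x) / (x:ℂ)) volume 1 p2 :=
    intervalIntegrable_of_continuousOn_Ioi
      (continuousOn_div_ofReal (continuousOn_comp_div cY hp2)) one_pos hp2
  have split : (∫ x in (1:ℝ)..p2,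
      (uL * Fl (p1 / x) / L1 + uS * Fs (p2 / x) / L2)
        * (vL * Gl (p1 / x) / L1 + vS * Gs (p2 / x) / L2) / x)
      = uL * vL / L1 ^ 2 * (∫ x in (1:ℝ)..p2, h66 (p1 / x) / x)
        + uS * vS / L2 ^ 2 * (∫ x in (1:ℝ)..p2, h77 (p2 / x) / x)
        + uS * vL / (L1 * L2) * (∫ x in (1:ℝ)..p2, hX (p2 / x) / x)
        + uL * vS / (L1 * L2) * (∫ x in (1:ℝ)..p2, hY (p2 / x) / x) := by
    rw [intervalIntegral.integral_congr expand,
      intervalIntegral.integral_add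
        ((I66.const_mul _).add (I77.const_mul _) |>.add (IX.const_mul _)) (IY.const_mul _),
      intervalIntegral.integral_add ((I66.const_mul _).add (I77.const_mul _)) (IX.const_mul _),
      intervalIntegral.integral_add (I66.const_mul _) (I77.const_mul _),
      intervalIntegral.integral_const_mul, intervalIntegral.integral_const_mul,
      intervalIntegral.integral_const_mul, intervalIntegral.integral_const_mul]
  have R66a : (∫ x in (1:ℝ)..p2, h66 (p1 / x) / x) = ∫ u in p1/p2..p1, h66 u / u := by
    have := integral_comp_div_inv one_pos hp2 hp1 h66
    rwa [div_one] at this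
  have R66b : (∫ x in p2..p1, h66 (p1 / x) / x) = ∫ u in (1:ℝ)..p1/p2, h66 u / u := by
    have := integral_comp_div_inv hp2 hp1 hp1 h66
    rwa [div_self hp1.ne'] at this
  have R77 : (∫ x in (1:ℝ)..p2, h77 (p2 / x) / x) = ∫ u in (1:ℝ)..p2, h77 u / u := by
    have := integral_comp_div_inv one_pos hp2 hp2 h77
    rwa [div_self hp2.ne', div_one] at this
  have RX : (∫ x in (1:ℝ)..p2, hX (p2 / x) / x) = ∫ u in (1:ℝ)..p2, hX u / u := by
    have := integral_comp_div_inv one_pos hp2 hp2 hX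
    rwa [div_self hp2.ne', div_one] at this
  have RY : (∫ x in (1:ℝ)..p2, hY (p2 / x) / x) = ∫ u in (1:ℝ)..p2, hY u / u := by
    have := integral_comp_div_inv one_pos hp2 hp2 hY
    rwa [div_self hp2.ne', div_one] at this
  have adj : (∫ u in (1:ℝ)..p1/p2, h66 u / u) + (∫ u in p1/p2..p1, h66 u / u)
      = ∫ u in (1:ℝ)..p1, h66 u / u :=
    intervalIntegral.integral_add_adjacent_intervals
      (intervalIntegrable_of_continuousOn_Ioi (continuousOn_div_ofReal c66) one_pos hc)
      (intervalIntegrable_of_continuousOn_Ioi (continuousOn_div_ofReal c66) hc hp1)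
  unfold S811g S812g
  simp only [← hp1def, ← hp2def]
  rw [split, R66a, R66b, R77, RX, RY, ← adj]
  simp only [h66, h77, hX, hY, L1, L2]
  ring

/-- **"Substituting `x = Pᶻ`", general coefficients and exponents** (`θ_L, θ_S ≠ 0`):
`S812g = u_L v_L(θ_L²Λ)⁻¹∫₀^{θ_L} f_L g_L + u_S v_S(θ_S²Λ)⁻¹∫₀^{θ_S} f_S g_S
  + (θ_Lθ_SΛ)⁻¹(u_S v_L∫₀^{θ_S} f_S(z)g_L(z+θ_L−θ_S) + u_L v_S∫₀^{θ_S} f_L(z+θ_L−θ_S)g_S(z))`,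
from `display818_diag`, `display818_cross₁`, `display818_cross₂`.
[cite: Zhang2022LandauSiegel, §8 displays after (8.18), §9] -/
theorem S812g_eq_zform (uL uS vL vS : ℂ) {Λ θL θS : ℝ} (hΛ : 0 < Λ) (hL : θL ≠ 0) (hS : θS ≠ 0)
    {Fl Fs Gl Gs fL fS gL gS : ℝ → ℂ}
    (eL : ∀ z, Fl (rexp (Λ * z)) = fL z) (eS : ∀ z, Fs (rexp (Λ * z)) = fS z)
    (dL : ∀ z, Gl (rexp (Λ * z)) = gL z) (dS : ∀ z, Gs (rexp (Λ * z)) = gS z) :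
    S812g uL uS vL vS Fl Fs Gl Gs Λ θL θS
      = uL * vL * ((1 / (θL ^ 2 * Λ) : ℝ) : ℂ) * (∫ z in (0:ℝ)..θL, fL z * gL z)
        + uS * vS * ((1 / (θS ^ 2 * Λ) : ℝ) : ℂ) * (∫ z in (0:ℝ)..θS, fS z * gS z)
        + ((1 / (θL * θS * Λ) : ℝ) : ℂ)
          * (uS * vL * (∫ z in (0:ℝ)..θS, fS z * gL (z + (θL - θS)))
              + uL * vS * (∫ z in (0:ℝ)..θS, fL (z + (θL - θS)) * gS z)) := by
  have A := display818_diag hΛ hL (F := Fl) (G := Gl) eL dL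
  have B := display818_diag hΛ hS (F := Fs) (G := Gs) eS dS
  have C := display818_cross₁ hΛ hL hS (F7 := Fs) (G6 := Gl) eS dL
  have D := display818_cross₂ hΛ hL hS (F6 := Fl) (G7 := Gs) eL dS
  unfold S812g
  have eA : uL * vL / (Real.log (Ppow Λ θL) : ℂ) ^ 2 * (∫ x in (1:ℝ)..Ppow Λ θL, Fl x * Gl x / x)
      = uL * vL * (1 / (Real.log (Ppow Λ θL) : ℂ) ^ 2
        * (∫ x in (1:ℝ)..Ppow Λ θL, Fl x * Gl x / x)) := by ring
  have eB : uS * vS / (Real.log (Ppow Λ θS) : ℂ) ^ 2 * (∫ x in (1:ℝ)..Ppow Λ θS, Fs x * Gs x / x)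
      = uS * vS * (1 / (Real.log (Ppow Λ θS) : ℂ) ^ 2
        * (∫ x in (1:ℝ)..Ppow Λ θS, Fs x * Gs x / x)) := by ring
  have eC : uS * vL / (Real.log (Ppow Λ θL) * Real.log (Ppow Λ θS) : ℂ)
        * (∫ x in (1:ℝ)..Ppow Λ θS, Fs x * Gl (Ppow Λ θL / Ppow Λ θS * x) / x)
      = uS * vL * (1 / (Real.log (Ppow Λ θL) * Real.log (Ppow Λ θS) : ℂ)
        * (∫ x in (1:ℝ)..Ppow Λ θS, Fs x * Gl (Ppow Λ θL / Ppow Λ θS * x) / x)) := by ring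
  have eD : uL * vS / (Real.log (Ppow Λ θL) * Real.log (Ppow Λ θS) : ℂ)
        * (∫ x in (1:ℝ)..Ppow Λ θS, Fl (Ppow Λ θL / Ppow Λ θS * x) * Gs x / x)
      = uL * vS * (1 / (Real.log (Ppow Λ θL) * Real.log (Ppow Λ θS) : ℂ)
        * (∫ x in (1:ℝ)..Ppow Λ θS, Fl (Ppow Λ θL / Ppow Λ θS * x) * Gs x / x)) := by ring
  rw [eA, A, eB, B, eC, C, eD, D]
  ring

/-! ### §9: the display for `S_j(a₁₂, a₂₂)` at main order, and (9.3)–(9.6) -/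

attribute [local fun_prop] continuous_ff16 continuous_ff26 continuous_ff36 continuous_ff17
  continuous_ff27 continuous_ff37 continuous_gh16 continuous_gh26 continuous_gh36 continuous_gh17
  continuous_gh27 continuous_gh37

/-- (9.3) with the three `j`-terms as separate integrals. [cite: Zhang2022LandauSiegel, (9.3)] -/
theorem b33_split : b33 = ((1 / (0.498 ^ 2 * π) : ℝ) : ℂ) *
    (1/2 * (∫ z in (0:ℝ)..0.498, ff16 z * gh16 z) + 2 * (∫ z in (0:ℝ)..0.498, ff26 z * gh26 z)
      + 3/2 * (∫ z in (0:ℝ)..0.498, ff36 z * gh36 z)) := by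
  unfold b33; rw [integral_wsum3] <;> fun_prop

/-- (9.5), prefactor `((0.5)(0.498)π)⁻¹` (`Section18Defs.b34c`), as three separate integrals.
[cite: Zhang2022LandauSiegel, (9.5)] -/
theorem b34c_split : b34c = ((1 / (0.5 * 0.498 * π) : ℝ) : ℂ) *
    (1/2 * (∫ z in (0:ℝ)..0.498, ff17 (z + 0.002) * gh16 z)
      + 2 * (∫ z in (0:ℝ)..0.498, ff27 (z + 0.002) * gh26 z)
      + 3/2 * (∫ z in (0:ℝ)..0.498, ff37 (z + 0.002) * gh36 z)) := by
  unfold b34c; rw [integral_wsum3] <;> fun_prop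

/-- (9.6), prefactor `((0.5)(0.498)π)⁻¹` (`Section18Defs.b43c`), as three separate integrals.
[cite: Zhang2022LandauSiegel, (9.6)] -/
theorem b43c_split : b43c = ((1 / (0.5 * 0.498 * π) : ℝ) : ℂ) *
    (1/2 * (∫ z in (0:ℝ)..0.498, ff16 z * gh17 (z + 0.002))
      + 2 * (∫ z in (0:ℝ)..0.498, ff26 z * gh27 (z + 0.002))
      + 3/2 * (∫ z in (0:ℝ)..0.498, ff36 z * gh37 (z + 0.002))) := by
  unfold b43c; rw [integral_wsum3] <;> fun_prop

/-- The printed prefactor `((0.504)(0.498)π)⁻¹` of (9.5)–(9.6) versus the derived one: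
`b34c = (0.504/0.5)·b34 = 1.008·b34`, `b43c = 1.008·b43`. [cite: Zhang2022LandauSiegel, (9.5)–(9.6)] -/
theorem prefactor_95_96 :
    b34c = ((0.504 / 0.5 : ℝ) : ℂ) * b34 ∧ b43c = ((0.504 / 0.5 : ℝ) : ℂ) * b43 := by
  have hπ : (π : ℂ) ≠ 0 := by exact_mod_cast Real.pi_ne_zero
  constructor
  · unfold b34c b34; push_cast; field_simp
  · unfold b43c b43; push_cast; field_simp

/-- `S₁(a₁₂,a₂₂)` of §9's display (p. 19) at main order: coefficients `(ῑ₄, ῑ₃; ι₄, ι₃)`, long profile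
`𝔣_{17}, 𝔤_{17}` at `P₂ = P^{θ_L}`, short profile `𝔣_{16}, 𝔤_{16}` at `P₃ = P^{θ_S}`
(`(β₂,β₃)` in `𝔤`); no `𝔞`, no `o(α)`. [cite: Zhang2022LandauSiegel, §9] -/
def S911main1 (α Λ θL θS : ℝ) : ℂ :=
  S811g (conj iota4) (conj iota3) iota4 iota3
    (fX 1 (5/2) α) (fX 1 (3/2) α) (gX 2 3 (5/2) α) (gX 2 3 (3/2) α) Λ θL θS

/-- `S₂(a₁₂,a₂₂)` of §9's display at main order (`j = 2`, `(β₃,β₁)`). [cite: Zhang2022LandauSiegel, §9] -/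
def S911main2 (α Λ θL θS : ℝ) : ℂ :=
  S811g (conj iota4) (conj iota3) iota4 iota3
    (fX 2 (5/2) α) (fX 2 (3/2) α) (gX 3 1 (5/2) α) (gX 3 1 (3/2) α) Λ θL θS

/-- `S₃(a₁₂,a₂₂)` of §9's display at main order (`j = 3`, `(β₁,β₂)`). [cite: Zhang2022LandauSiegel, §9] -/
def S911main3 (α Λ θL θS : ℝ) : ℂ :=
  S811g (conj iota4) (conj iota3) iota4 iota3
    (fX 3 (5/2) α) (fX 3 (3/2) α) (gX 1 2 (5/2) α) (gX 1 2 (3/2) α) Λ θL θS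

/-- **§9's display "`(2α)⁻¹S₁ + 2α⁻¹S₂ + (3/2)α⁻¹S₃ = 𝔞(|ι₃|²b₃₃ + ι₃ῑ₄b₃₄ + ι₄ῑ₃b₄₃ + |ι₄|²b₄₄) + o(1)`",
PROVED EXACTLY at main order and DECIDING THE PREFACTOR**: with `α log P = π`, `P₂ = P^{0.5}` (main value
of (2.21)), `P₃ = P^{0.498}` and the shifts at their main values, the weighted sum of the §9 display's
expressions equals `|ι₃|²·b33 + ι₃ῑ₄·b34c + ι₄ῑ₃·b43c + |ι₄|²·b44` — (9.3), (9.4) as printed and (9.5),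
(9.6) with prefactor `((0.5)(0.498)π)⁻¹` (`Section18Defs.b34c`, `b43c`; the printed `0.504` would
require `log P₁` where the display has `log P₂`). [cite: Zhang2022LandauSiegel, §9, (9.3)–(9.6)] -/
theorem weighted_sum_S911_main {α Λ : ℝ} (hα : 0 < α) (hΛ : 0 < Λ) (h : α * Λ = π) :
    1 / (2 * (α : ℂ)) * S911main1 α Λ 0.5 0.498 + 2 / (α : ℂ) * S911main2 α Λ 0.5 0.498
        + 3 / (2 * (α : ℂ)) * S911main3 α Λ 0.5 0.498
      = (Complex.normSq iota3 : ℂ) * b33 + iota3 * conj iota4 * b34c + iota4 * conj iota3 * b43c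
        + (Complex.normSq iota4 : ℂ) * b44 := by
  have hα0 : α ≠ 0 := hα.ne'
  have hαC : (α : ℂ) ≠ 0 := by exact_mod_cast hα0
  have hΛC : (Λ : ℂ) ≠ 0 := by exact_mod_cast hΛ.ne'
  have hL : (0.5 : ℝ) ≠ 0 := by norm_num
  have hS : (0.498 : ℝ) ≠ 0 := by norm_num
  have hδ : (0.5 : ℝ) - 0.498 = 0.002 := by norm_num
  have hπ : (π : ℂ) = (α : ℂ) * Λ := by rw [← Complex.ofReal_mul, h]
  unfold S911main1 S911main2 S911main3
  rw [S811g_eq_S812g _ _ _ _ (continuousOn_fX _ _ _) (continuousOn_fX _ _ _) (continuousOn_gX _ _ _ _)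
      (continuousOn_gX _ _ _ _),
    S811g_eq_S812g _ _ _ _ (continuousOn_fX _ _ _) (continuousOn_fX _ _ _) (continuousOn_gX _ _ _ _)
      (continuousOn_gX _ _ _ _),
    S811g_eq_S812g _ _ _ _ (continuousOn_fX _ _ _) (continuousOn_fX _ _ _) (continuousOn_gX _ _ _ _)
      (continuousOn_gX _ _ _ _)]
  rw [S812g_eq_zform _ _ _ _ hΛ hL hS (fL := ff17) (fS := ff16) (gL := gh17) (gS := gh16)
      (fun z => by rw [fX_exp, frakf_main_17 h]) (fun z => by rw [fX_exp, frakf_main_16 h])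
      (fun z => by rw [gX_exp, frakg_main_17 hα0 h]) (fun z => by rw [gX_exp, frakg_main_16 hα0 h]),
    S812g_eq_zform _ _ _ _ hΛ hL hS (fL := ff27) (fS := ff26) (gL := gh27) (gS := gh26)
      (fun z => by rw [fX_exp, frakf_main_27 h]) (fun z => by rw [fX_exp, frakf_main_26 h])
      (fun z => by rw [gX_exp, frakg_main_27 hα0 h]) (fun z => by rw [gX_exp, frakg_main_26 hα0 h]),
    S812g_eq_zform _ _ _ _ hΛ hL hS (fL := ff37) (fS := ff36) (gL := gh37) (gS := gh36)
      (fun z => by rw [fX_exp, frakf_main_37 h]) (fun z => by rw [fX_exp, frakf_main_36 h])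
      (fun z => by rw [gX_exp, frakg_main_37 hα0 h]) (fun z => by rw [gX_exp, frakg_main_36 hα0 h]),
    hδ, b33_split, b34c_split, b43c_split]
  unfold b44
  rw [b22_split, ← Complex.mul_conj iota3, ← Complex.mul_conj iota4]
  push_cast
  rw [hπ]
  field_simp
  ring

/-! ### (9.7): `𝔠₂` -/

/-- The main-term coefficient of `Θ₁(a₁₂,a₂₂)/(𝔞𝔓)` (display after (9.6)) in the derived reading:
`B₂ := |ι₃|²b₃₃ + ι₃ῑ₄·b34c + ι₄ῑ₃·b43c + |ι₄|²b₄₄`. [cite: Zhang2022LandauSiegel, §9 after (9.6)] -/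
def Theta1Coeff9 : ℂ :=
  (Complex.normSq iota3 : ℂ) * b33 + iota3 * conj iota4 * b34c + iota4 * conj iota3 * b43c
    + (Complex.normSq iota4 : ℂ) * b44

/-- (9.1) + the display after (9.7) (`c₃₃ = b₃₃ + b̄₃₃`, `c₄₄ = c₂₂`, `c₃₄ = b₃₄ + b̄₄₃`, `c₄₃ = c̄₃₄`,
`𝔠₂ = |ι₃|²c₃₃ + ι₃ῑ₄c₃₄ + ι₄ῑ₃c₄₃ + |ι₄|²c₄₄`), in the derived reading: `frakc2c = B₂ + B̄₂` — pure
algebra. [cite: Zhang2022LandauSiegel, (9.1), (9.7)] -/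
theorem frakc2c_eq_coeff_add_conj : frakc2c = Theta1Coeff9 + conj Theta1Coeff9 := by
  unfold frakc2c Theta1Coeff9 c43c
  unfold c34c c33 c44 c22 b44
  simp only [map_add, map_mul, Complex.conj_conj, Complex.conj_ofReal]
  ring

/-- **End to end at main order for §9.** Let `W` be the weighted sum of the §9 display's expressions
(`α log P = π`, `P₂ = P^{0.5}`, `P₃ = P^{0.498}`, shifts at main values). Then `W + W̄ = frakc2c`
(the `((0.5)(0.498)π)⁻¹` reading of `𝔠₂`, `= 6.98709…`), the printed (9.8) `𝔠₂ < 6.9955` HOLDS for it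
(`Section18Certificate.ineq98c`), and `W + W̄` is NOT the printed-prefactor value `frakc2 = 6.99491…`
(`frakc2_re_bounds`). [cite: Zhang2022LandauSiegel, §9, (9.7), (9.8)] -/
theorem weighted_sum_S911_add_conj {α Λ : ℝ} (hα : 0 < α) (hΛ : 0 < Λ) (h : α * Λ = π) :
    let W := 1 / (2 * (α : ℂ)) * S911main1 α Λ 0.5 0.498 + 2 / (α : ℂ) * S911main2 α Λ 0.5 0.498
      + 3 / (2 * (α : ℂ)) * S911main3 α Λ 0.5 0.498
    W + conj W = frakc2c ∧ (W + conj W).re < 6.9955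
      ∧ (6.987092 : ℝ) < (W + conj W).re ∧ (W + conj W).re < 6.987093 ∧ W + conj W ≠ frakc2 := by
  intro W
  have hW : W = Theta1Coeff9 := weighted_sum_S911_main hα hΛ h
  have e : W + conj W = frakc2c := by rw [hW, frakc2c_eq_coeff_add_conj]
  refine ⟨e, ?_, ?_, ?_, ?_⟩
  · rw [e]; exact ineq98c
  · rw [e]; exact frakc2c_re_bounds.1
  · rw [e]; exact frakc2c_re_bounds.2
  · rw [e]
    intro hc
    have h1 := frakc2c_re_bounds.2
    have h2 := frakc2_re_bounds.1
    rw [hc] at h1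
    linarith

end Literature.NumberTheory.LFunctions.Zhang2022
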